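import Literature.Geometry.Lorentzian.KerrDeSitterRadialTSLadderThreeHalves
import HarnessLib

/-!
# Half-integer spin `|s| = 3/2` on the real axis, V: the value of the Teukolsky–Starobinsky form at
# a simple root on the SINGULAR (ingoing) branch — the event-horizon endpoint

HONEST LABEL. The second of the two endpoint evaluations needed to turn the conservation law of
file II into the `s = 3/2` energy identity: the RIGHT LIMIT at a simple root `p` of `Δ` of
`W(x; R(x), R′(x))` on a solution of the ingoing (singular) branch `R = (x − p)^{−3/2 − iβ}f`,
`βΔ′(p) = K̃(p)`, `f` smooth. Here the three terms of `W` diverge separately; the finite value is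
  `lim_{x ↓ p} W = −ℭ·Δ′(p)/(4β² + 1/4)·|f(p)|²`,
`ℭ = tsqTSConst` the Teukolsky–Starobinsky constant of the generic even-quartic equation (on
Kerr–de Sitter: Wu–Yan's `|C_{3/2}|²`), proved as `tendsto_tsqForm_singular` (generic) — by the
ladder of file IV: `W = Ψ/(x − p)` with `Ψ = σ²n₁₁|f|² + 2σRe(n₁₂ f conj H₁) + p₂₂|H₁|²`,
`H₁ = τf + σf′` the regular factor of the first rung `P₁ = (x−p)^{−1/2−iβ}H₁`; the ladder equation
gives the order-one Frobenius relation `(1/2 + 2iβ)H₁(p) + c(p)f(p) = 0` by continuity; at the root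
`n₁₁ = |c|²`, `n₁₂ = σc(1/2 − 2iβ)`, `p₂₂ = (1/4 + 4β²)σ²`, so
`Ψ = σ²|(1/2 + 2iβ)H₁ + cf|² + (x − p)Ψ₁` with `Ψ₁` continuous at `p`, and the first term is
`o(x − p)`. ONE jet order of `f` enters (through `H₁(p)`); `f″` cancels. This file contains NO
statement about radial solutions vanishing (that is the assembly, file VI). Definitions with
bodies + theorems, NO named facts.

Sources: [Costa2019] Proposition 2.21 (the half-integer energy identity: the weight
`(2ω)^{2s−1}ℭ_s` at the singular end); [WuYan2004] Appendix A (A5)–(A6) (the ladder operators and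
the constant `|C_{3/2}|²`); [CasalsTeixeiradacosta2022] Definition 3.3 (ingoing at `𝓗⁺`),
Theorem 3.10.
-/

noncomputable section

open Complex Set Filter Topology

open scoped ComplexConjugate

namespace Literature.Geometry.Lorentzian.KerrDeSitter

/-! ### The Teukolsky–Starobinsky constant of the generic even quartic -/

/-- **The spin-`3/2` Teukolsky–Starobinsky constant of the generic even-quartic equation**,
`ℭ = (λ² − 4d₀d₄)(λ + d₂) − 16(λk₀k₂ − d₄k₀² − d₀k₂²) + d₁²d₄` with `λ = λ̃ − d₂/3`; on
Kerr–de Sitter (`d₀ = a²`, `d₁ = −2M`, `d₂ = 1 − α`, `d₄ = −Λ/3`, `k₀ = Ξ(ωa² − am)`, `k₂ = Ξω`,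
`λ̃ = λ + (1−α)/3`) this is Wu–Yan's
`|C_{3/2}|² = (λ² + 4a²Λ/3)(λ + 1 − α) − 16Ξ²(λaω(aω − m) + α(aω − m)² − a²ω²) − 4M²Λ/3`.
[cite: WuYan2004, Appendix A, (A6)] -/
def tsqTSConst (d₀ d₁ d₂ d₄ k₀ k₂ el : ℝ) : ℝ :=
  ((el - d₂ / 3) ^ 2 - 4 * d₀ * d₄) * (el - d₂ / 3 + d₂) -
    16 * ((el - d₂ / 3) * k₀ * k₂ - d₄ * k₀ ^ 2 - d₀ * k₂ ^ 2) + d₁ ^ 2 * d₄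

/-! ### Private plumbing -/

/-- `|u^z|² = u^{2Re z}` for a positive real base (private plumbing). [folklore] -/
private theorem normSq_ofReal_cpow {u : ℝ} (hu : 0 < u) (z : ℂ) :
    normSq (((u : ℝ) : ℂ) ^ z) = u ^ (2 * z.re) := by
  rw [normSq_eq_norm_sq, norm_cpow_eq_rpow_re_of_pos hu, ← Real.rpow_natCast,
    ← Real.rpow_mul hu.le]
  congr 1
  push_cast
  ring

/-- The derivative of a branch `S = u^z·g` on an open set where `S` and `g` are differentiable:
`S' = z u^{z−1} u' g + u^z g'` (uniqueness of derivatives; private plumbing). [folklore] -/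
private theorem deriv_eq_of_cpowBranch' {J : Set ℝ} (hJ : IsOpen J) {g g' : ℝ → ℂ}
    (hg : ∀ x ∈ J, HasDerivAt g (g' x) x) {u : ℝ → ℝ} {c : ℝ} (hu : ∀ x, HasDerivAt u c x)
    (hupos : ∀ x ∈ J, 0 < u x) (z : ℂ) {S S' : ℝ → ℂ} (hS : ∀ x ∈ J, HasDerivAt S (S' x) x)
    (hSg : ∀ x ∈ J, S x = ((u x : ℝ) : ℂ) ^ z * g x) :
    ∀ x ∈ J, S' x = z * ((u x : ℝ) : ℂ) ^ (z - 1) * (c : ℂ) * g x + ((u x : ℝ) : ℂ) ^ z * g' x := by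
  intro x hx
  have hux : HasDerivAt (fun y => ((u y : ℝ) : ℂ)) (c : ℂ) x := (hu x).ofReal_comp
  have hslit : ((u x : ℝ) : ℂ) ∈ slitPlane := ofReal_mem_slitPlane.2 (hupos x hx)
  have hpow' : HasDerivAt ((fun w : ℂ => w ^ z) ∘ fun y => ((u y : ℝ) : ℂ))
      (z * ((u x : ℝ) : ℂ) ^ (z - 1) * (c : ℂ)) x :=
    (hasStrictDerivAt_cpow_const (c := z) hslit).hasDerivAt.comp x hux
  have hpow : HasDerivAt (fun y => ((u y : ℝ) : ℂ) ^ z)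
      (z * ((u x : ℝ) : ℂ) ^ (z - 1) * (c : ℂ)) x := by
    simpa only [Function.comp_def] using hpow'
  have hprod := hpow.mul (hg x hx)
  have heq : S =ᶠ[𝓝 x] fun y => ((u y : ℝ) : ℂ) ^ z * g y :=
    Filter.eventually_of_mem (hJ.mem_nhds hx) fun y hy => hSg y hy
  exact (hS x hx).unique (hprod.congr_of_eventuallyEq heq)

/-- The derivative of `p₂₂′` (an explicit quadratic). [cite: WuYan2004, Appendix A, (A5)] -/
theorem hasDerivAt_tsqP22d (d₀ d₁ d₂ d₄ k₀ k₂ el r : ℝ) :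
    HasDerivAt (fun x => tsqP22d d₀ d₁ d₂ d₄ k₀ k₂ el x)
      (2 * (-4 * d₀ * d₄ + (1 / 3 : ℝ) * d₂ ^ 2 - d₂ * el + 8 * k₀ * k₂) +
        6 * (-2 * d₁ * d₄) * r +
        12 * (-(2 / 3 : ℝ) * d₂ * d₄ - d₄ * el + 4 * k₂ ^ 2) * r ^ 2) r := by
  have h := (((hasDerivAt_const r ((1 / 3 : ℝ) * d₁ * d₂ - d₁ * el)).fun_add
    ((hasDerivAt_id' r).const_mul (2 * (-4 * d₀ * d₄ + (1 / 3 : ℝ) * d₂ ^ 2 - d₂ * el +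
      8 * k₀ * k₂)))).fun_add ((hasDerivAt_pow 2 r).const_mul (3 * (-2 * d₁ * d₄)))).fun_add
    ((hasDerivAt_pow 3 r).const_mul (4 * (-(2 / 3 : ℝ) * d₂ * d₄ - d₄ * el + 4 * k₂ ^ 2)))
  have hf : (fun x => (1 / 3 : ℝ) * d₁ * d₂ - d₁ * el +
      2 * (-4 * d₀ * d₄ + (1 / 3 : ℝ) * d₂ ^ 2 - d₂ * el + 8 * k₀ * k₂) * x +
      3 * (-2 * d₁ * d₄) * x ^ 2 + 4 * (-(2 / 3 : ℝ) * d₂ * d₄ - d₄ * el + 4 * k₂ ^ 2) * x ^ 3) =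
      fun x => tsqP22d d₀ d₁ d₂ d₄ k₀ k₂ el x := by
    funext x; unfold tsqP22d; ring
  rw [hf] at h
  refine h.congr_deriv ?_
  simp only [Nat.cast_ofNat]
  ring

/-- Real-variable elimination behind the endpoint value (private plumbing): if
`(1/2 + 2iβ)h + c·g = 0` then `(1/4 + 4β²)·[−4d₄D³|g|² + 2D Re(Q g conj h) + Q₂|h|²] =`
`[−4d₄D³(1/4 + 4β²) − 2D Re(Q conj(c) (1/2 + 2iβ)) + Q₂|c|²]·|g|²`. [folklore] -/
private theorem endpoint_elim (β D d₄ Q₂ : ℝ) (Q c g h : ℂ)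
    (hE : (((1 / 2 : ℝ) : ℂ) + I * ((2 * β : ℝ) : ℂ)) * h + c * g = 0) :
    (1 / 4 + 4 * β ^ 2) * (-4 * d₄ * D ^ 3 * normSq g + 2 * D * (Q * g * conj h).re +
        Q₂ * normSq h) =
      (-4 * d₄ * D ^ 3 * (1 / 4 + 4 * β ^ 2) -
          2 * D * (Q * conj c * (((1 / 2 : ℝ) : ℂ) + I * ((2 * β : ℝ) : ℂ))).re +
          Q₂ * normSq c) * normSq g := by
  have hre := congrArg Complex.re hE
  have him := congrArg Complex.im hE
  simp only [add_re, add_im, mul_re, mul_im, ofReal_re, ofReal_im, I_re, I_im, zero_re, zero_im]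
    at hre him
  have hw : (1 / 4 + 4 * β ^ 2 : ℝ) ≠ 0 := by positivity
  -- solve `h` in terms of `c g`
  have hhr : h.re = -((c.re * g.re - c.im * g.im) / 2 + 2 * β * (c.re * g.im + c.im * g.re)) /
      (1 / 4 + 4 * β ^ 2) := by
    rw [eq_div_iff hw]
    linear_combination (1 / 2) * hre + 2 * β * him
  have hhi : h.im = -((c.re * g.im + c.im * g.re) / 2 - 2 * β * (c.re * g.re - c.im * g.im)) /
      (1 / 4 + 4 * β ^ 2) := by
    rw [eq_div_iff hw]
    linear_combination (1 / 2) * him - 2 * β * hre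
  simp only [normSq_apply, mul_re, mul_im, add_re, add_im, conj_re, conj_im, ofReal_re, ofReal_im,
    I_re, I_im]
  rw [hhr, hhi]
  field_simp
  ring

/-- The branch algebra in the ladder basis (private plumbing): with `R = Q·f/u`, `P₁ = Q·H`,
`|Q|² = u⁻¹`, the ladder form `(uσ)²n|R|² + 2Re(uσ·N·R·conj P₁) + p₂₂|P₁|²` equals
`(σ²n|f|² + 2Re(σ N f conj H) + p₂₂|H|²)/u`. [folklore] -/
private theorem ladder_branch_eq {σ n p22 u : ℝ} {N Q f H : ℂ} (hu : u ≠ 0)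
    (hQ : normSq Q = u⁻¹) :
    (u * σ) ^ 2 * n * normSq (Q * f / (u : ℂ)) +
        2 * ((((u * σ : ℝ)) : ℂ) * N * (Q * f / (u : ℂ)) * conj (Q * H)).re + p22 * normSq (Q * H) =
      (σ ^ 2 * n * normSq f + 2 * ((σ : ℂ) * N * f * conj H).re + p22 * normSq H) / u := by
  have huc : (u : ℂ) ≠ 0 := by exact_mod_cast hu
  have h1 : normSq (Q * f / (u : ℂ)) = normSq Q * normSq f / u ^ 2 := by
    rw [map_div₀, map_mul, normSq_ofReal]; ring
  have h2 : (((u * σ : ℝ)) : ℂ) * N * (Q * f / (u : ℂ)) * conj (Q * H) =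
      (σ : ℂ) * N * f * conj H * (Q * conj Q) := by
    simp only [map_mul]
    push_cast
    field_simp
  have h3 : normSq (Q * H) = normSq Q * normSq H := map_mul _ _ _
  rw [h1, h2, h3, mul_conj, hQ]
  simp only [mul_re, mul_im, ofReal_re, ofReal_im, conj_re, conj_im]
  field_simp
  ring

/-! ### The singular-branch endpoint (generic even quartic) -/

/-- **Limit of the spin-`3/2` form on the singular branch at a simple root (generic even
quartic).** Let `p` be a root of `Δ` with `Δ′(p) ≠ 0`, `β` real with `β·Δ′(p) = K̃(p)`, let `R`
solve the spin-`3/2` equation `Δ²R″ + (5/2)ΔΔ′R′ + N_V R = 0` on `(p, hi)` (with `Δ ≠ 0` there),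
and let `R` be of the SINGULAR-branch form `R·(x − p)^{3/2 + iβ} = f` on `(p, p + ε)` with `f`
smooth on `(p − ε, p + ε)`. Then `W(x; R(x), R′(x)) → −ℭ·Δ′(p)/(1/4 + 4β²)·|f(p)|²` as `x ↓ p`,
`ℭ = tsqTSConst`. Mechanism (file IV): `W = Ψ/(x − p)`,
`Ψ = σ²|(1/2 + 2iβ)H₁ + cf|² + (x − p)Ψ₁` with `H₁ = τf + σf′` the regular factor of the first rung,
`(1/2 + 2iβ)H₁(p) + c(p)f(p) = 0` from the ladder equation by continuity (so the first term is
`o(x − p)`), and `Ψ₁(p)` explicit; `f″` cancels. [cite: Costa2019, Proposition 2.21] -/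
theorem tendsto_tsqForm_singular {d₀ d₁ d₂ d₄ k₀ k₂ el p hi β : ℝ}
    (hΔp : tsqDelta d₀ d₁ d₂ d₄ p = 0) (hD : tsqDeltaD d₁ d₂ d₄ p ≠ 0)
    (hβ : β * tsqDeltaD d₁ d₂ d₄ p = tsqK k₀ k₂ p) (hhi : p < hi)
    (hΔJ : ∀ x ∈ Ioo p hi, tsqDelta d₀ d₁ d₂ d₄ x ≠ 0) {R R' R'' : ℝ → ℂ}
    (hode : ∀ x ∈ Ioo p hi, HasDerivAt R (R' x) x ∧ HasDerivAt R' (R'' x) x ∧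
      (tsqDelta d₀ d₁ d₂ d₄ x : ℂ) ^ 2 * R'' x +
        5 / 2 * (tsqDelta d₀ d₁ d₂ d₄ x : ℂ) * (tsqDeltaD d₁ d₂ d₄ x : ℂ) * R' x +
        ((tsqNVre d₀ d₁ d₂ d₄ k₀ k₂ el x : ℂ) + I * (tsqNVim d₀ d₁ d₂ d₄ k₀ k₂ x : ℂ)) * R x = 0)
    {ε : ℝ} (hε : 0 < ε) {f : ℝ → ℂ}
    (hf : ContDiffOn ℝ ((⊤ : ℕ∞) : WithTop ℕ∞) f (Ioo (p - ε) (p + ε)))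
    (hRf : ∀ x ∈ Ioo p (p + ε),
      R x * ((x - p : ℝ) : ℂ) ^ ((((3 / 2 : ℝ)) : ℂ) + I * (β : ℂ)) = f x) :
    Tendsto (fun x => tsqForm d₀ d₁ d₂ d₄ k₀ k₂ el x (R x) (R' x)) (𝓝[>] p)
      (𝓝 (-(tsqTSConst d₀ d₁ d₂ d₄ k₀ k₂ el * tsqDeltaD d₁ d₂ d₄ p) / (1 / 4 + 4 * β ^ 2) *
        normSq (f p))) := by
  have h1top : (1 : WithTop ℕ∞) ≤ ((⊤ : ℕ∞) : WithTop ℕ∞) := by exact_mod_cast le_top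
  have h0top : ((⊤ : ℕ∞) : WithTop ℕ∞) ≠ 0 := by simp
  -- data eliminated at the root: `d₀`, `k₀`
  have hd₀ : d₀ = -(d₁ * p + d₂ * p ^ 2 + d₄ * p ^ 4) := by
    unfold tsqDelta at hΔp; linarith
  have hk₀ : k₀ = β * tsqDeltaD d₁ d₂ d₄ p - k₂ * p ^ 2 := by
    unfold tsqK at hβ; linarith
  set D : ℝ := tsqDeltaD d₁ d₂ d₄ p with hD_def
  -- the exponent
  set z : ℂ := -((((3 / 2 : ℝ)) : ℂ) + I * (β : ℂ)) with hz
  have hzre : z.re = -(3 / 2) := by rw [hz]; simp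
  set w : ℂ := (((1 / 2 : ℝ)) : ℂ) + I * ((2 * β : ℝ) : ℂ) with hw
  have hw0 : w ≠ 0 := by
    intro h0
    have := congrArg Complex.re h0
    simp [hw] at this
  -- `Δ = (x − p)σ`, `σ(p) = D`, `σ − D = (x − p)σ₁`, `Δ′ = σ + (x − p)σd`
  obtain ⟨σ, hσ⟩ : ∃ σ : ℝ → ℝ, σ = fun x => d₁ + d₂ * (x + p) +
      d₄ * (x ^ 3 + x ^ 2 * p + x * p ^ 2 + p ^ 3) := ⟨_, rfl⟩
  obtain ⟨σd, hσd⟩ : ∃ σd : ℝ → ℝ, σd = fun x => d₂ + d₄ * (3 * x ^ 2 + 2 * x * p + p ^ 2) :=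
    ⟨_, rfl⟩
  obtain ⟨σ₁, hσ₁⟩ : ∃ σ₁ : ℝ → ℝ, σ₁ = fun x => d₂ + d₄ * (x ^ 2 + 2 * x * p + 3 * p ^ 2) :=
    ⟨_, rfl⟩
  have hΔσ : ∀ x, tsqDelta d₀ d₁ d₂ d₄ x = (x - p) * σ x := by
    intro x; rw [hσ, hd₀]; unfold tsqDelta; ring
  have hDσ : ∀ x, tsqDeltaD d₁ d₂ d₄ x = σ x + (x - p) * σd x := by
    intro x; rw [hσ, hσd]; unfold tsqDeltaD; ring
  have hσp : σ p = D := by rw [hσ, hD_def]; unfold tsqDeltaD; ring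
  have hσ₁x : ∀ x, σ x = D + (x - p) * σ₁ x := by
    intro x; rw [hσ, hσ₁, hD_def]; unfold tsqDeltaD; ring
  have hσc : Continuous σ := by rw [hσ]; fun_prop
  have hσdc : Continuous σd := by rw [hσd]; fun_prop
  have hσhas : ∀ x, HasDerivAt σ (σd x) x := by
    intro x
    have h := (((hasDerivAt_const x (d₁ + d₂ * p + d₄ * p ^ 3)).fun_add
      ((hasDerivAt_id' x).const_mul (d₂ + d₄ * p ^ 2))).fun_add
      ((hasDerivAt_pow 2 x).const_mul (d₄ * p))).fun_add ((hasDerivAt_pow 3 x).const_mul d₄)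
    have hf' : (fun y => d₁ + d₂ * p + d₄ * p ^ 3 + (d₂ + d₄ * p ^ 2) * y + d₄ * p * y ^ 2 +
        d₄ * y ^ 3) = σ := by
      rw [hσ]; funext y; ring
    rw [hf'] at h
    refine h.congr_deriv ?_
    rw [hσd]; simp only [Nat.cast_ofNat]; ring
  have hσJ : ∀ x ∈ Ioo p hi, σ x ≠ 0 := by
    intro x hx h0
    exact hΔJ x hx (by rw [hΔσ x, h0, mul_zero])
  -- `τ`: `σz + a = (x − p)τ`
  obtain ⟨τ, hτ⟩ : ∃ τ : ℝ → ℂ, τ = fun x => (((3 / 2 * σd x : ℝ)) : ℂ) +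
      I * ((k₂ * (x + p) - β * σ₁ x : ℝ) : ℂ) := ⟨_, rfl⟩
  obtain ⟨τd, hτd⟩ : ∃ τd : ℝ → ℂ, τd = fun x => (((3 / 2 * (d₄ * (6 * x + 2 * p)) : ℝ)) : ℂ) +
      I * ((k₂ - β * (d₄ * (2 * x + 2 * p)) : ℝ) : ℂ) := ⟨_, rfl⟩
  have hT1 : ∀ x, (σ x : ℂ) * z + ((((3 / 2 * tsqDeltaD d₁ d₂ d₄ x : ℝ)) : ℂ) +
      I * (tsqK k₀ k₂ x : ℂ)) = ((x - p : ℝ) : ℂ) * τ x := by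
    intro x
    have hKx : tsqK k₀ k₂ x = β * D + k₂ * ((x - p) * (x + p)) := by
      unfold tsqK; rw [hk₀]; ring
    rw [hKx, hDσ x, hτ, hz]
    simp only
    rw [show σ x = D + (x - p) * σ₁ x from hσ₁x x]
    push_cast
    ring
  have hτc : Continuous τ := by rw [hτ, hσd, hσ₁]; fun_prop
  have hτdc : Continuous τd := by rw [hτd]; fun_prop
  have hτhas : ∀ x, HasDerivAt τ (τd x) x := by
    intro x
    have hσdhas : HasDerivAt σd (d₄ * (6 * x + 2 * p)) x := by
      have h := ((hasDerivAt_const x (d₂ + d₄ * p ^ 2)).fun_add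
        ((hasDerivAt_id' x).const_mul (2 * d₄ * p))).fun_add
        ((hasDerivAt_pow 2 x).const_mul (3 * d₄))
      have hf' : (fun y => d₂ + d₄ * p ^ 2 + 2 * d₄ * p * y + 3 * d₄ * y ^ 2) = σd := by
        rw [hσd]; funext y; ring
      rw [hf'] at h
      refine h.congr_deriv ?_
      simp only [Nat.cast_ofNat]; ring
    have hσ₁has : HasDerivAt σ₁ (d₄ * (2 * x + 2 * p)) x := by
      have h := ((hasDerivAt_const x (d₂ + 3 * d₄ * p ^ 2)).fun_add
        ((hasDerivAt_id' x).const_mul (2 * d₄ * p))).fun_add ((hasDerivAt_pow 2 x).const_mul d₄)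
      have hf' : (fun y => d₂ + 3 * d₄ * p ^ 2 + 2 * d₄ * p * y + d₄ * y ^ 2) = σ₁ := by
        rw [hσ₁]; funext y; ring
      rw [hf'] at h
      refine h.congr_deriv ?_
      simp only [Nat.cast_ofNat]; ring
    have hA : HasDerivAt (fun y => (((3 / 2 * σd y : ℝ)) : ℂ))
        (((3 / 2 * (d₄ * (6 * x + 2 * p)) : ℝ) : ℂ)) x := (hσdhas.const_mul (3 / 2)).ofReal_comp
    have hB : HasDerivAt (fun y => ((k₂ * (y + p) - β * σ₁ y : ℝ) : ℂ))
        (((k₂ - β * (d₄ * (2 * x + 2 * p))) : ℝ) : ℂ) x := by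
      have h1 : HasDerivAt (fun y : ℝ => k₂ * (y + p)) (k₂ * 1) x :=
        ((hasDerivAt_id' x).add_const p).const_mul k₂
      have h := (h1.sub (hσ₁has.const_mul β)).ofReal_comp
      refine h.congr_deriv ?_
      push_cast; ring
    rw [hτ, hτd]
    exact hA.add (hB.const_mul I)
  -- the interval `J` and the branch representations
  have hUo : IsOpen (Ioo (p - ε) (p + ε)) := isOpen_Ioo
  have hpU : p ∈ Ioo (p - ε) (p + ε) := ⟨by linarith, by linarith⟩
  have hb : p < min (p + ε) hi := lt_min (by linarith) hhi
  have hJU : Ioo p (min (p + ε) hi) ⊆ Ioo (p - ε) (p + ε) := fun x hx =>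
    ⟨by linarith [hx.1], lt_of_lt_of_le hx.2 (min_le_left _ _)⟩
  have hJD : Ioo p (min (p + ε) hi) ⊆ Ioo p hi := fun x hx =>
    ⟨hx.1, lt_of_lt_of_le hx.2 (min_le_right _ _)⟩
  have hfd : DifferentiableOn ℝ f (Ioo (p - ε) (p + ε)) := hf.differentiableOn h0top
  have hf1 : ContDiffOn ℝ ((⊤ : ℕ∞) : WithTop ℕ∞) (deriv f) (Ioo (p - ε) (p + ε)) :=
    ((contDiffOn_infty_iff_deriv_of_isOpen hUo).1 hf).2
  have hf1d : DifferentiableOn ℝ (deriv f) (Ioo (p - ε) (p + ε)) := hf1.differentiableOn h0top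
  have hfhas : ∀ x ∈ Ioo (p - ε) (p + ε), HasDerivAt f (deriv f x) x := fun x hx =>
    ((hfd x hx).differentiableAt (hUo.mem_nhds hx)).hasDerivAt
  have hf'has : ∀ x ∈ Ioo (p - ε) (p + ε), HasDerivAt (deriv f) (deriv (deriv f) x) x := fun x hx =>
    ((hf1d x hx).differentiableAt (hUo.mem_nhds hx)).hasDerivAt
  have hfc : ContinuousAt f p := (hfhas p hpU).continuousAt
  have hf'c : ContinuousAt (deriv f) p := (hf'has p hpU).continuousAt
  have hf''c : ContinuousAt (deriv (deriv f)) p :=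
    ((hf1.continuousOn_deriv_of_isOpen hUo h1top).continuousWithinAt hpU).continuousAt
      (hUo.mem_nhds hpU)
  have hRJ : ∀ x ∈ Ioo p (min (p + ε) hi), R x = ((x - p : ℝ) : ℂ) ^ z * f x := by
    intro x hx
    have hx0 : (0 : ℝ) < x - p := by linarith [hx.1]
    have hne : ((x - p : ℝ) : ℂ) ≠ 0 := by exact_mod_cast hx0.ne'
    have h := hRf x ⟨hx.1, lt_of_lt_of_le hx.2 (min_le_left _ _)⟩
    have hpow : ((x - p : ℝ) : ℂ) ^ ((((3 / 2 : ℝ)) : ℂ) + I * (β : ℂ)) ≠ 0 := by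
      rw [Ne, cpow_eq_zero_iff, not_and_or]; exact Or.inl hne
    rw [hz, cpow_neg, ← h, mul_comm (R x) _, ← mul_assoc, inv_mul_cancel₀ hpow, one_mul]
  have hR'J := deriv_eq_of_cpowBranch' isOpen_Ioo (fun x hx => hfhas x (hJU hx))
    (u := fun x => x - p) (c := 1) (fun x => (hasDerivAt_id' x).sub_const _)
    (fun x hx => by simp only [sub_pos]; exact hx.1) z (S := R) (S' := R')
    (fun x hx => (hode x (hJD hx)).1) hRJ
  -- the regular factor `H₁ = τ f + σ f′` of the first rung, and its derivative
  obtain ⟨H₁, hH₁⟩ : ∃ H₁ : ℝ → ℂ, H₁ = fun x => τ x * f x + (σ x : ℂ) * deriv f x := ⟨_, rfl⟩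
  obtain ⟨H₁d, hH₁d⟩ : ∃ H₁d : ℝ → ℂ, H₁d = fun x => τd x * f x + τ x * deriv f x +
      ((σd x : ℂ) * deriv f x + (σ x : ℂ) * deriv (deriv f) x) := ⟨_, rfl⟩
  have hH₁has : ∀ x ∈ Ioo (p - ε) (p + ε), HasDerivAt H₁ (H₁d x) x := by
    intro x hx
    have hσ' : HasDerivAt (fun y => (σ y : ℂ)) ((σd x : ℝ) : ℂ) x := (hσhas x).ofReal_comp
    have h := ((hτhas x).fun_mul (hfhas x hx)).fun_add (hσ'.fun_mul (hf'has x hx))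
    rw [hH₁, hH₁d]
    exact h
  have hH₁c : ContinuousAt H₁ p := (hH₁has p hpU).continuousAt
  have hH₁dc : ContinuousAt H₁d p := by
    rw [hH₁d]
    have hσC : ContinuousAt (fun x => ((σ x : ℝ) : ℂ)) p := hσc.continuousAt.ofReal
    have hσdC : ContinuousAt (fun x => ((σd x : ℝ) : ℂ)) p := hσdc.continuousAt.ofReal
    exact ((hτdc.continuousAt.mul hfc).add (hτc.continuousAt.mul hf'c)).add
      ((hσdC.mul hf'c).add (hσC.mul hf''c))
  -- `P₁ = (x − p)^{z+1} H₁` on `J`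
  have hP1J : ∀ x ∈ Ioo p (min (p + ε) hi),
      (tsqDelta d₀ d₁ d₂ d₄ x : ℂ) * R' x +
        ((((3 / 2 * tsqDeltaD d₁ d₂ d₄ x : ℝ)) : ℂ) + I * (tsqK k₀ k₂ x : ℂ)) * R x =
      ((x - p : ℝ) : ℂ) ^ (z + 1) * H₁ x := by
    intro x hx
    have hx0 : (0 : ℝ) < x - p := by linarith [hx.1]
    have hne : ((x - p : ℝ) : ℂ) ≠ 0 := by exact_mod_cast hx0.ne'
    have e1 : ((x - p : ℝ) : ℂ) ^ z = ((x - p : ℝ) : ℂ) ^ (z - 1) * ((x - p : ℝ) : ℂ) := by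
      rw [cpow_sub _ _ hne, cpow_one, div_mul_cancel₀ _ hne]
    have e2 : ((x - p : ℝ) : ℂ) ^ (z + 1) =
        ((x - p : ℝ) : ℂ) ^ (z - 1) * ((x - p : ℝ) : ℂ) ^ 2 := by
      rw [cpow_add _ _ hne, cpow_one, e1]; ring
    rw [hR'J x hx, hRJ x hx, e1, e2, hH₁]
    simp only
    have hΔx : (tsqDelta d₀ d₁ d₂ d₄ x : ℂ) = ((x - p : ℝ) : ℂ) * (σ x : ℂ) := by
      rw [hΔσ x]; push_cast; ring
    rw [hΔx]
    simp only [ofReal_one, mul_one]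
    linear_combination (((x - p : ℝ) : ℂ) ^ (z - 1) * ((x - p : ℝ) : ℂ) * f x) * hT1 x
  -- the ladder equation along the branch: `(z+1)σH₁ + (x−p)σH₁′ = iK̃H₁ + σ c f` on `J`
  have hrel : ∀ x ∈ Ioo p (min (p + ε) hi),
      (z + 1) * (σ x : ℂ) * H₁ x + ((x - p : ℝ) : ℂ) * (σ x : ℂ) * H₁d x -
        I * (tsqK k₀ k₂ x : ℂ) * H₁ x -
        (σ x : ℂ) * ((tsqCre d₂ d₄ el x : ℂ) + I * (tsqCim k₂ x : ℂ)) * f x = 0 := by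
    intro x hx
    have hx0 : (0 : ℝ) < x - p := by linarith [hx.1]
    have hne : ((x - p : ℝ) : ℂ) ≠ 0 := by exact_mod_cast hx0.ne'
    have hσx : (σ x : ℂ) ≠ 0 := by exact_mod_cast hσJ x (hJD hx)
    -- the derivative of `P₁` from the branch representation equals the ladder value
    have hS := deriv_eq_of_cpowBranch' isOpen_Ioo (fun y hy => hH₁has y (hJU hy))
      (u := fun x => x - p) (c := 1) (fun x => (hasDerivAt_id' x).sub_const _)
      (fun x hx => by simp only [sub_pos]; exact hx.1) (z + 1)
      (S := fun y => (tsqDelta d₀ d₁ d₂ d₄ y : ℂ) * R' y +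
        ((((3 / 2 * tsqDeltaD d₁ d₂ d₄ y : ℝ)) : ℂ) + I * (tsqK k₀ k₂ y : ℂ)) * R y)
      (fun y hy => by
        obtain ⟨h1', h2', heq'⟩ := hode y (hJD hy)
        exact hasDerivAt_tsqLadder (hΔJ y (hJD hy)) h1' h2' heq') hP1J x hx
    rw [hP1J x hx, hRJ x hx] at hS
    have e0 : ((x - p : ℝ) : ℂ) ^ (z + 1 - 1) = ((x - p : ℝ) : ℂ) ^ z := by
      rw [add_sub_cancel_right]
    have e1 : ((x - p : ℝ) : ℂ) ^ (z + 1) = ((x - p : ℝ) : ℂ) ^ z * ((x - p : ℝ) : ℂ) := by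
      rw [cpow_add _ _ hne, cpow_one]
    have hΔx : (tsqDelta d₀ d₁ d₂ d₄ x : ℂ) = ((x - p : ℝ) : ℂ) * (σ x : ℂ) := by
      rw [hΔσ x]; push_cast; ring
    rw [e0, e1, hΔx] at hS
    have hzpow : ((x - p : ℝ) : ℂ) ^ z ≠ 0 := by
      rw [Ne, cpow_eq_zero_iff, not_and_or]; exact Or.inl hne
    have hS' := hS
    simp only [ofReal_one, mul_one] at hS'
    -- clear the denominator `(x − p)σ` and cancel the common factor `(x − p)^z (x − p)`
    field_simp at hS'
    linear_combination (-1 : ℂ) * hS'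
  -- continuity at `p` of the relation ⇒ the order-one Frobenius relation
  have hKp : tsqK k₀ k₂ p = β * D := by unfold tsqK; rw [hk₀]; ring
  have hDc : (D : ℂ) ≠ 0 := by exact_mod_cast hD
  have hE : w * H₁ p + ((tsqCre d₂ d₄ el p : ℂ) + I * (tsqCim k₂ p : ℂ)) * f p = 0 := by
    obtain ⟨Γ, hΓ⟩ : ∃ Γ : ℝ → ℂ, Γ = fun x => (z + 1) * (σ x : ℂ) * H₁ x +
        ((x - p : ℝ) : ℂ) * (σ x : ℂ) * H₁d x - I * (tsqK k₀ k₂ x : ℂ) * H₁ x -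
        (σ x : ℂ) * ((tsqCre d₂ d₄ el x : ℂ) + I * (tsqCim k₂ x : ℂ)) * f x := ⟨_, rfl⟩
    have hΓc : ContinuousAt Γ p := by
      have hσC : ContinuousAt (fun x => ((σ x : ℝ) : ℂ)) p := hσc.continuousAt.ofReal
      have hKc : Continuous fun x : ℝ => (tsqK k₀ k₂ x : ℂ) := by unfold tsqK; fun_prop
      have hcc : Continuous fun x : ℝ => (tsqCre d₂ d₄ el x : ℂ) + I * (tsqCim k₂ x : ℂ) := by
        unfold tsqCre tsqCim; fun_prop
      have hu : ContinuousAt (fun x : ℝ => ((x - p : ℝ) : ℂ)) p := by fun_prop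
      rw [hΓ]
      exact ((((continuousAt_const.mul hσC).mul hH₁c).add ((hu.mul hσC).mul hH₁dc)).sub
        ((continuous_const.mul hKc).continuousAt.mul hH₁c)).sub ((hσC.mul hcc.continuousAt).mul hfc)
    have hlim1 : Tendsto Γ (𝓝[>] p) (𝓝 (Γ p)) := hΓc.tendsto.mono_left nhdsWithin_le_nhds
    have hlim0 : Tendsto Γ (𝓝[>] p) (𝓝 0) := by
      refine (tendsto_const_nhds (x := (0 : ℂ))).congr' ?_
      filter_upwards [Ioo_mem_nhdsGT hb] with x hx
      rw [hΓ]
      exact (hrel x hx).symm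
    have hΓp : Γ p = 0 := tendsto_nhds_unique hlim1 hlim0
    rw [hΓ] at hΓp
    simp only [sub_self, ofReal_zero, zero_mul, add_zero] at hΓp
    rw [hKp, hσp, hz] at hΓp
    have h2 : (D : ℂ) * (w * H₁ p + ((tsqCre d₂ d₄ el p : ℂ) + I * (tsqCim k₂ p : ℂ)) * f p) =
        0 := by
      rw [hw]
      push_cast at hΓp ⊢
      linear_combination (-1 : ℂ) * hΓp
    exact (mul_eq_zero.1 h2).resolve_left hDc
  -- `W = Ψ/(x − p)` on `J`, `Ψ = σ²|wH₁ + cf|² + (x − p)Ψ₁`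
  obtain ⟨q₁, hq₁⟩ : ∃ q₁ : ℝ → ℂ, q₁ = fun x => ((tsqN12re d₀ d₁ d₂ d₄ k₀ k₂ el x : ℂ) +
      I * (tsqN12im d₀ d₁ d₂ d₄ k₀ k₂ el x : ℂ)) -
      (σ x : ℂ) * ((tsqCre d₂ d₄ el x : ℂ) + I * (tsqCim k₂ x : ℂ)) * conj w := ⟨_, rfl⟩
  obtain ⟨q₂, hq₂⟩ : ∃ q₂ : ℝ → ℝ, q₂ = fun x => tsqP22 d₀ d₁ d₂ d₄ k₀ k₂ el x -
      (1 / 4 + 4 * β ^ 2) * σ x ^ 2 := ⟨_, rfl⟩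
  have hq₁p : q₁ p = 0 := by
    rw [hq₁, hw]
    simp only [map_add, map_mul, conj_ofReal, conj_I]
    rw [hσp, hD_def]
    unfold tsqN12re tsqN12im tsqP22d tsqCre tsqCim tsqK tsqDeltaD tsqDelta
    rw [hd₀, hk₀, hD_def]
    unfold tsqDeltaD
    push_cast
    linear_combination (-(8 : ℂ) * (β : ℂ) * (k₂ : ℂ) * (p : ℂ) *
      ((d₁ : ℂ) + 2 * (d₂ : ℂ) * (p : ℂ) + 4 * (d₄ : ℂ) * (p : ℂ) ^ 3)) * I_sq
  have hq₂p : q₂ p = 0 := by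
    rw [hq₂]; simp only; rw [hσp, hD_def]
    unfold tsqP22 tsqDeltaD
    rw [hd₀, hk₀, hD_def]; unfold tsqDeltaD
    ring
  obtain ⟨m, hm⟩ : ∃ m : ℝ → ℂ, m = fun x => w * H₁ x +
      ((tsqCre d₂ d₄ el x : ℂ) + I * (tsqCim k₂ x : ℂ)) * f x := ⟨_, rfl⟩
  have hWJ : ∀ x ∈ Ioo p (min (p + ε) hi), tsqForm d₀ d₁ d₂ d₄ k₀ k₂ el x (R x) (R' x) =
      σ x ^ 2 * normSq (m x) / (x - p) +
        (-4 * d₄ * σ x ^ 3 * normSq (f x) +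
          2 * σ x * (q₁ x / ((x - p : ℝ) : ℂ) * f x * conj (H₁ x)).re +
          q₂ x / (x - p) * normSq (H₁ x)) := by
    intro x hx
    have hx0 : (0 : ℝ) < x - p := by linarith [hx.1]
    have hu : (x - p) ≠ 0 := hx0.ne'
    have hne : ((x - p : ℝ) : ℂ) ≠ 0 := by exact_mod_cast hx0.ne'
    have hnpow : normSq (((x - p : ℝ) : ℂ) ^ (z + 1)) = (x - p)⁻¹ := by
      rw [normSq_ofReal_cpow hx0, add_re, hzre, one_re]
      norm_num
      exact Real.rpow_neg_one (x - p)
    have hRx : R x = ((x - p : ℝ) : ℂ) ^ (z + 1) * f x / ((x - p : ℝ) : ℂ) := by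
      rw [hRJ x hx, cpow_add _ _ hne, cpow_one]; field_simp
    rw [tsqForm_eq_ladder, hP1J x hx, hRx, hΔσ x, ladder_branch_eq hu hnpow]
    rw [hm, hq₁, hq₂, hw]
    simp only [tsqN11]
    rw [hΔσ x]
    simp only [normSq_apply, mul_re, mul_im, add_re, add_im, sub_re, sub_im, conj_re, conj_im,
      ofReal_re, ofReal_im, I_re, I_im, neg_re, neg_im, div_ofReal_re, div_ofReal_im, map_add,
      map_mul, conj_ofReal, conj_I]
    field_simp
    ring
  -- limits of the pieces
  -- (i) `m := wH₁ + cf` has `m(p) = 0`, so `|m|²/(x−p) → 0`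
  have hmp : m p = 0 := by rw [hm]; exact hE
  have hcre : ∀ x, HasDerivAt (fun y => tsqCre d₂ d₄ el y) (-(4 * d₄ * x)) x := by
    intro x
    have h := (hasDerivAt_const x (el - d₂ / 3)).fun_sub ((hasDerivAt_pow 2 x).const_mul (2 * d₄))
    have hf' : (fun y => el - d₂ / 3 - 2 * d₄ * y ^ 2) = fun y => tsqCre d₂ d₄ el y := by
      funext y; unfold tsqCre; ring
    rw [hf'] at h
    refine h.congr_deriv ?_
    simp only [Nat.cast_ofNat]; ring
  have hcim : ∀ x, HasDerivAt (fun y => tsqCim k₂ y) (-(4 * k₂)) x := by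
    intro x
    have h := (hasDerivAt_id' x).const_mul (-(4 * k₂))
    have hf' : (fun y => -(4 * k₂) * y) = fun y => tsqCim k₂ y := by
      funext y; unfold tsqCim; ring
    rw [hf'] at h
    refine h.congr_deriv ?_
    ring
  have hchas : ∀ x, HasDerivAt (fun y => (tsqCre d₂ d₄ el y : ℂ) + I * (tsqCim k₂ y : ℂ))
      (((-(4 * d₄ * x) : ℝ) : ℂ) + I * (((-(4 * k₂)) : ℝ) : ℂ)) x := fun x =>
    (hcre x).ofReal_comp.add ((hcim x).ofReal_comp.const_mul I)
  have hmhas : HasDerivAt m (w * H₁d p +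
      ((((-(4 * d₄ * p) : ℝ) : ℂ) + I * (((-(4 * k₂)) : ℝ) : ℂ)) * f p +
        ((tsqCre d₂ d₄ el p : ℂ) + I * (tsqCim k₂ p : ℂ)) * deriv f p)) p := by
    rw [hm]
    exact ((hH₁has p hpU).const_mul w).add ((hchas p).mul (hfhas p hpU))
  have hlim_m : Tendsto (fun x => m x / ((x - p : ℝ) : ℂ)) (𝓝[>] p)
      (𝓝 (w * H₁d p + ((((-(4 * d₄ * p) : ℝ) : ℂ) + I * (((-(4 * k₂)) : ℝ) : ℂ)) * f p +
        ((tsqCre d₂ d₄ el p : ℂ) + I * (tsqCim k₂ p : ℂ)) * deriv f p))) := by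
    have h := hmhas.tendsto_slope
    have h' := h.mono_left (nhdsWithin_mono p (show Ioi p ⊆ {p}ᶜ from fun x hx =>
      ne_of_gt (mem_Ioi.1 hx)))
    refine h'.congr' ?_
    filter_upwards [self_mem_nhdsWithin] with x hx
    rw [slope_def_module, hmp, sub_zero, Complex.real_smul, ofReal_inv, div_eq_inv_mul]
  have hlim_sq : Tendsto (fun x => σ x ^ 2 * normSq (m x) / (x - p)) (𝓝[>] p) (𝓝 0) := by
    have h1 : Tendsto (fun x => normSq (m x / ((x - p : ℝ) : ℂ))) (𝓝[>] p) (𝓝 (normSq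
        (w * H₁d p + ((((-(4 * d₄ * p) : ℝ) : ℂ) + I * (((-(4 * k₂)) : ℝ) : ℂ)) * f p +
          ((tsqCre d₂ d₄ el p : ℂ) + I * (tsqCim k₂ p : ℂ)) * deriv f p)))) :=
      (continuous_normSq.tendsto _).comp hlim_m
    have h2 : Tendsto (fun x : ℝ => x - p) (𝓝[>] p) (𝓝 0) := by
      have : Tendsto (fun x : ℝ => x - p) (𝓝 p) (𝓝 (p - p)) :=
        (continuous_id.sub continuous_const).tendsto p
      rw [sub_self] at this
      exact this.mono_left nhdsWithin_le_nhds
    have h3 : Tendsto (fun x => σ x ^ 2) (𝓝[>] p) (𝓝 (σ p ^ 2)) :=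
      ((hσc.pow 2).tendsto p).mono_left nhdsWithin_le_nhds
    have h := (h3.mul h1).mul h2
    rw [mul_zero] at h
    refine h.congr' ?_
    filter_upwards [self_mem_nhdsWithin] with x hx
    have hx0 : (0 : ℝ) < x - p := by simpa using hx
    rw [normSq_div, normSq_ofReal]
    field_simp
  -- (ii) `q₁/(x−p) → q₁′(p)`, `q₂/(x−p) → q₂′(p)` (slopes at a zero)
  have hN12re : HasDerivAt (fun x => tsqN12re d₀ d₁ d₂ d₄ k₀ k₂ el x)
      (-(2 * (-4 * d₀ * d₄ + (1 / 3 : ℝ) * d₂ ^ 2 - d₂ * el + 8 * k₀ * k₂) +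
        6 * (-2 * d₁ * d₄) * p + 12 * (-(2 / 3 : ℝ) * d₂ * d₄ - d₄ * el + 4 * k₂ ^ 2) * p ^ 2) / 2)
      p := by
    have h := (hasDerivAt_tsqP22d d₀ d₁ d₂ d₄ k₀ k₂ el p).neg.div_const 2
    refine (h.congr_of_eventuallyEq ?_)
    exact Filter.Eventually.of_forall fun x => by simp [tsqN12re, neg_div]
  have hN12im : HasDerivAt (fun x => tsqN12im d₀ d₁ d₂ d₄ k₀ k₂ el x)
      (-2 * (-(4 * d₄ * p) * tsqK k₀ k₂ p + tsqCre d₂ d₄ el p * (2 * k₂ * p)) +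
        (-(4 * k₂) * tsqDeltaD d₁ d₂ d₄ p + tsqCim k₂ p * tsqDeltaDD d₂ d₄ p) / 2 +
        4 * k₂ * tsqDeltaD d₁ d₂ d₄ p) p := by
    have h := ((((hcre p).fun_mul (hasDerivAt_tsqK k₀ k₂ p)).const_mul (-2)).fun_add
      (((hcim p).fun_mul (hasDerivAt_tsqDeltaD d₁ d₂ d₄ p)).div_const 2)).fun_add
      ((hasDerivAt_tsqDelta d₀ d₁ d₂ d₄ p).const_mul (4 * k₂))
    have hf' : (fun x => -2 * (tsqCre d₂ d₄ el x * tsqK k₀ k₂ x) +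
        tsqCim k₂ x * tsqDeltaD d₁ d₂ d₄ x / 2 + 4 * k₂ * tsqDelta d₀ d₁ d₂ d₄ x) =
        fun x => tsqN12im d₀ d₁ d₂ d₄ k₀ k₂ el x := by
      funext x; unfold tsqN12im; ring
    rw [hf'] at h
    refine h.congr_deriv ?_
    ring
  have hσ' : HasDerivAt (fun y => (σ y : ℂ)) ((σd p : ℝ) : ℂ) p := (hσhas p).ofReal_comp
  have hF₁ := (hN12re.ofReal_comp.fun_add (hN12im.ofReal_comp.const_mul I)).fun_sub
    ((hσ'.fun_mul (hchas p)).mul_const (conj w))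
  obtain ⟨Q₁, hQ₁, hF₁'⟩ : ∃ Q₁ : ℂ, HasDerivAt q₁ Q₁ p ∧
      HasDerivAt (fun y => ((tsqN12re d₀ d₁ d₂ d₄ k₀ k₂ el y : ℂ) +
        I * (tsqN12im d₀ d₁ d₂ d₄ k₀ k₂ el y : ℂ)) -
        (σ y : ℂ) * ((tsqCre d₂ d₄ el y : ℂ) + I * (tsqCim k₂ y : ℂ)) * conj w) Q₁ p :=
    ⟨_, by rw [hq₁]; exact hF₁, hF₁⟩
  have hF₂ := (hasDerivAt_tsqP22 d₀ d₁ d₂ d₄ k₀ k₂ el p).fun_sub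
    (((hσhas p).pow 2).const_mul (1 / 4 + 4 * β ^ 2))
  obtain ⟨Q₂, hQ₂, hF₂'⟩ : ∃ Q₂ : ℝ, HasDerivAt q₂ Q₂ p ∧
      HasDerivAt (fun y => tsqP22 d₀ d₁ d₂ d₄ k₀ k₂ el y - (1 / 4 + 4 * β ^ 2) * σ y ^ 2) Q₂ p :=
    ⟨_, by rw [hq₂]; exact hF₂, hF₂⟩
  have hlim_q₁ : Tendsto (fun x => q₁ x / ((x - p : ℝ) : ℂ)) (𝓝[>] p) (𝓝 Q₁) := by
    have h := hQ₁.tendsto_slope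
    have h' := h.mono_left (nhdsWithin_mono p (show Ioi p ⊆ {p}ᶜ from fun x hx =>
      ne_of_gt (mem_Ioi.1 hx)))
    refine h'.congr' ?_
    filter_upwards [self_mem_nhdsWithin] with x hx
    rw [slope_def_module, hq₁p, sub_zero, Complex.real_smul, ofReal_inv, div_eq_inv_mul]
  have hlim_q₂ : Tendsto (fun x => q₂ x / (x - p)) (𝓝[>] p) (𝓝 Q₂) := by
    have h := hQ₂.tendsto_slope
    have h' := h.mono_left (nhdsWithin_mono p (show Ioi p ⊆ {p}ᶜ from fun x hx =>
      ne_of_gt (mem_Ioi.1 hx)))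
    refine h'.congr' ?_
    filter_upwards [self_mem_nhdsWithin] with x hx
    rw [slope_def_field, hq₂p, sub_zero]
  -- (iii) the limit of `Ψ₁`
  have hlim_Ψ₁ : Tendsto (fun x => -4 * d₄ * σ x ^ 3 * normSq (f x) +
      2 * σ x * (q₁ x / ((x - p : ℝ) : ℂ) * f x * conj (H₁ x)).re +
      q₂ x / (x - p) * normSq (H₁ x)) (𝓝[>] p)
      (𝓝 (-4 * d₄ * D ^ 3 * normSq (f p) + 2 * D * (Q₁ * f p * conj (H₁ p)).re +
        Q₂ * normSq (H₁ p))) := by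
    have tσ : Tendsto σ (𝓝[>] p) (𝓝 D) := by
      rw [← hσp]; exact (hσc.tendsto p).mono_left nhdsWithin_le_nhds
    have tf : Tendsto f (𝓝[>] p) (𝓝 (f p)) := hfc.tendsto.mono_left nhdsWithin_le_nhds
    have tH : Tendsto H₁ (𝓝[>] p) (𝓝 (H₁ p)) := hH₁c.tendsto.mono_left nhdsWithin_le_nhds
    have tHb : Tendsto (fun x => conj (H₁ x)) (𝓝[>] p) (𝓝 (conj (H₁ p))) :=
      (continuous_conj.tendsto _).comp tH
    have t1 : Tendsto (fun x => -4 * d₄ * σ x ^ 3 * normSq (f x)) (𝓝[>] p)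
        (𝓝 (-4 * d₄ * D ^ 3 * normSq (f p))) :=
      ((tσ.pow 3).const_mul _).mul ((continuous_normSq.tendsto _).comp tf)
    have t2 : Tendsto (fun x => 2 * σ x * (q₁ x / ((x - p : ℝ) : ℂ) * f x * conj (H₁ x)).re)
        (𝓝[>] p) (𝓝 (2 * D * (Q₁ * f p * conj (H₁ p)).re)) :=
      (tσ.const_mul 2).mul ((continuous_re.tendsto _).comp ((hlim_q₁.mul tf).mul tHb))
    have t3 : Tendsto (fun x => q₂ x / (x - p) * normSq (H₁ x)) (𝓝[>] p)
        (𝓝 (Q₂ * normSq (H₁ p))) :=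
      hlim_q₂.mul ((continuous_normSq.tendsto _).comp tH)
    exact (t1.add t2).add t3
  have hlim := hlim_sq.add hlim_Ψ₁
  rw [zero_add] at hlim
  -- the value: `(1/4 + 4β²)·L = −ℭ·D·|f(p)|²`
  have hval : (1 / 4 + 4 * β ^ 2) * (-4 * d₄ * D ^ 3 * normSq (f p) +
      2 * D * (Q₁ * f p * conj (H₁ p)).re + Q₂ * normSq (H₁ p)) =
      -(tsqTSConst d₀ d₁ d₂ d₄ k₀ k₂ el * D) * normSq (f p) := by
    rw [endpoint_elim β D d₄ Q₂ Q₁ _ (f p) (H₁ p) (by rw [hw] at hE; exact hE)]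
    congr 1
    -- the polynomial identity at the root
    have hQ₁v := hF₁.unique hF₁'
    have hQ₂v := hF₂.unique hF₂'
    rw [← hQ₁v, ← hQ₂v, hw]
    simp only [map_add, map_mul, conj_ofReal, conj_I, mul_re, mul_im, add_re, add_im, sub_re,
      sub_im, ofReal_re, ofReal_im, I_re, I_im, neg_re, neg_im, normSq_apply, Nat.cast_ofNat]
    rw [hσp, show σd p = d₂ + 6 * d₄ * p ^ 2 by rw [hσd]; ring]
    unfold tsqTSConst tsqCre tsqCim tsqK tsqDeltaD tsqDeltaDD tsqP22d
    rw [hd₀, hk₀, hD_def]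
    unfold tsqDeltaD
    ring
  have hw2 : (1 / 4 + 4 * β ^ 2 : ℝ) ≠ 0 := by positivity
  have hL : -4 * d₄ * D ^ 3 * normSq (f p) + 2 * D * (Q₁ * f p * conj (H₁ p)).re +
      Q₂ * normSq (H₁ p) =
      -(tsqTSConst d₀ d₁ d₂ d₄ k₀ k₂ el * D) / (1 / 4 + 4 * β ^ 2) * normSq (f p) := by
    have h' : -4 * d₄ * D ^ 3 * normSq (f p) + 2 * D * (Q₁ * f p * conj (H₁ p)).re +
        Q₂ * normSq (H₁ p) =
        (-(tsqTSConst d₀ d₁ d₂ d₄ k₀ k₂ el * D) * normSq (f p)) / (1 / 4 + 4 * β ^ 2) := by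
      rw [eq_div_iff hw2]
      linear_combination hval
    rw [h']
    ring
  rw [hL] at hlim
  refine hlim.congr' ?_
  filter_upwards [Ioo_mem_nhdsGT hb] with x hx
  exact (hWJ x hx).symm

end Literature.Geometry.Lorentzian.KerrDeSitter

end
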